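import Mathlib
import HarnessLib

/-!
# `RationalShortRootRigidity` — Step 1 helper (m10): full `p₀`-degree is multiplicative

Helper lemma INSIDE the paper proof of crux `stmt-QuantumFields-23124` (`F4SubCurvatureDoor.RationalShortRootRigidity`,
LINE g15-A of planner ym-idea-3; Step 1 = `stub_reduce`; free-hands menu IV, item (m10), statement typed in
HOME l15/Helpers23124c.lean as `Helpers.FullDegMul` — proved here DEF-FREE, with `FullDeg X` unfolded to its body
`MvPolynomial.coeff (Finsupp.single 0 X.totalDegree) X ≠ 0` exactly as in the crux text):

**Lemma** (`fullDegMul`).  For non-zero `A, B ∈ ℝ[p₀,…,p₃]`, the product `A·B` has full degree in `p₀` iff both `A` and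
`B` do.  Indeed (`coeff_single_zero_mul`, valid for all `A, B`) the `p₀^{deg A + deg B}`-coefficient of `A·B` is the
product of the `p₀^{deg A}`-coefficient of `A` and the `p₀^{deg B}`-coefficient of `B`: in `MvPolynomial.coeff_mul` a pair of
exponents summing to `p₀^{deg A + deg B}` consists of pure powers `p₀^a, p₀^b`, and unless `a = deg A` one of the two
coefficients vanishes for degree reasons (`coeff_eq_zero_of_totalDegree_lt`); and `deg(A·B) = deg A + deg B` in the domain
`ℝ[p]` (`totalDegree_mul_of_isDomain`).

Mathlib only; THEOREMS ONLY (no definitions); no named facts; no `sorry`; default heartbeats.  Nothing about the crux 23124,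
the route's rung or the Yang–Mills mass gap is proved here.  Free-hands seat `ym-line-frs-p2` g10 (announced on the owner's bus
2026-08-28T20:28Z), `--supports stmt-QuantumFields-23124`.
-/

set_option autoImplicit false

namespace Summit.QuantumFields.YangMills.Theorems.RationalShortRootRigidity

open scoped BigOperators

/-- An exponent vector below a pure power of `p₀` is a pure power of `p₀`. [folklore] -/
theorem eq_single_of_add_eq_single {n : ℕ} (d e : Fin 4 →₀ ℕ) (h : d + e = Finsupp.single 0 n) :
    d = Finsupp.single 0 (d 0) := by
  ext i
  by_cases hi : i = 0
  · subst hi; rw [Finsupp.single_eq_same]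
  · have h1 := congrArg (fun f => f i) h
    simp only [Finsupp.add_apply, Finsupp.single_apply, if_neg (Ne.symm hi)] at h1
    rw [Finsupp.single_apply, if_neg (Ne.symm hi)]
    omega

/-- The degree of the pure power `p₀^m` is `m`. [folklore] -/
theorem sum_support_single_zero (m : ℕ) : ∑ i ∈ (Finsupp.single (0 : Fin 4) m).support, (Finsupp.single (0 : Fin 4) m) i = m := by
  show (Finsupp.single (0 : Fin 4) m).sum (fun _ e => e) = m
  exact Finsupp.sum_single_index rfl

/-- The `p₀^{deg A + deg B}`-coefficient of a product is the product of the top `p₀`-coefficients. [folklore] -/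
theorem coeff_single_zero_mul (A B : MvPolynomial (Fin 4) ℝ) :
    MvPolynomial.coeff (Finsupp.single 0 (A.totalDegree + B.totalDegree)) (A * B) =
      MvPolynomial.coeff (Finsupp.single 0 A.totalDegree) A *
        MvPolynomial.coeff (Finsupp.single 0 B.totalDegree) B := by
  classical
  rw [MvPolynomial.coeff_mul]
  rw [Finset.sum_eq_single (Finsupp.single 0 A.totalDegree, Finsupp.single 0 B.totalDegree)]
  · intro p hp hne
    rw [Finset.HasAntidiagonal.mem_antidiagonal] at hp
    have h1 : p.1 = Finsupp.single 0 (p.1 0) := eq_single_of_add_eq_single p.1 p.2 hp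
    have h2 : p.2 = Finsupp.single 0 (p.2 0) := eq_single_of_add_eq_single p.2 p.1 (by rw [add_comm]; exact hp)
    have hsum : p.1 0 + p.2 0 = A.totalDegree + B.totalDegree := by
      have := congrArg (fun f => f 0) hp
      simpa only [Finsupp.add_apply, Finsupp.single_eq_same] using this
    rcases Nat.lt_trichotomy (p.1 0) A.totalDegree with hlt | heq | hgt
    · have hB : MvPolynomial.coeff p.2 B = 0 := by
        apply MvPolynomial.coeff_eq_zero_of_totalDegree_lt
        rw [h2, sum_support_single_zero]
        omega
      rw [hB, mul_zero]
    · exfalso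
      apply hne
      have heq2 : p.2 0 = B.totalDegree := by omega
      exact Prod.ext (by rw [h1, heq]) (by rw [h2, heq2])
    · have hA : MvPolynomial.coeff p.1 A = 0 := by
        apply MvPolynomial.coeff_eq_zero_of_totalDegree_lt
        rw [h1, sum_support_single_zero]
        exact hgt
      rw [hA, zero_mul]
  · intro hnot
    exfalso
    exact hnot (by rw [Finset.HasAntidiagonal.mem_antidiagonal, ← Finsupp.single_add])

/-- **Full `p₀`-degree is multiplicative** (m10; Step 1 of the paper proof of 23124).  The statement is the body of
`Helpers.FullDegMul` (HOME l15/Helpers23124c.lean) with `FullDeg` unfolded as in the crux text. [folklore] -/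
theorem fullDegMul :
    ∀ A B : MvPolynomial (Fin 4) ℝ, A ≠ 0 → B ≠ 0 →
      (MvPolynomial.coeff (Finsupp.single 0 (A * B).totalDegree) (A * B) ≠ 0 ↔
        MvPolynomial.coeff (Finsupp.single 0 A.totalDegree) A ≠ 0 ∧
          MvPolynomial.coeff (Finsupp.single 0 B.totalDegree) B ≠ 0) := by
  intro A B hA hB
  rw [MvPolynomial.totalDegree_mul_of_isDomain hA hB, coeff_single_zero_mul, mul_ne_zero_iff]

end Summit.QuantumFields.YangMills.Theorems.RationalShortRootRigidity
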